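import Literature.Probability.FitznerVanDerHofstad2017.SrwLawBesselEGF
import Literature.Probability.FitznerVanDerHofstad2017.SrwIntegralMonotone
import HarnessLib

/-!
# The seven Green-function classes of `ℤ³` with `|x|₁ ≤ 3` reduce to the return probabilities
# (symmetries of the `n`-step law, summation by parts in one coordinate, and the six class relations)

Hara–Slade–Sokal's loop-erasure bounds of order `(2̃,1)` [HSS93, §3.2 eqs. (3.13)/(3.18), §4.1 and Table 2 p. 14: `μ(ℤ³) ≥
4.572 140`] consume the simple-random-walk Green function `C₀(0,x;1/2d) = G(x) = Σₙ pₙ(x)` at the seven site classes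
`x ∈ {0, e₁, 2e₁, e₁+e₂, 3e₁, 2e₁+e₂, e₁+e₂+e₃}` [HSS93, Appendix A.1 pp. 27–30, Table 4].  In `d = 3` the generic head-plus-
uniform-tail enclosure of the tree (`GreenNbhd.srwI_one_bounds`, files `SAWLoopErasureGreenNeighbourhood*` for `4 ≤ d ≤ 21`) is
useless: the tail `Σ_{n ≥ 512} pₙ(x) ≈ 0.03` decays like `N^{-1/2}`.  This file removes the obstruction at the level of exact
identities: **every one of the seven class values `pₙ(x)` is an explicit rational combination of at most three consecutive
return probabilities `q_k = p_{2k}(0)`**, so that two-sided tail bounds for the single sequence `(q_k)` (Zagier's recurrence for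
`c_{2k}(0) = C(2k,k)·Σ_j C(k,j)²C(2j,j)`, ratio majorant/minorant and telescoping potentials — the companion files) give all seven
Green functions of `ℤ³` to full precision.

The inputs are three elementary facts about the `n`-step law `pₙ = srwLaw 3 n` (defined in the tree by the one-step recursion):

* **§1 symmetries**: the tree's signed-permutation invariance `srwLaw_spAct` (`SrwIntegralMonotone`), in the concrete form
  `u = spAct τ x ⇒ pₙ(u) = pₙ(x)` for the swaps and single reflections of `ℤ³` that are needed (`srwLaw_three_swaps/_reflects`).
* **§2 summation by parts in the last coordinate** (any `d`): for sites `x⁻, x⁺, x⁰` agreeing off the last coordinate, with last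
  coordinates `t−1, t+1, t`,  `(m+1)·(c_m(x⁻) − c_m(x⁺)) = t·c_{m+1}(x⁰)` (`srwCount_parts`, `srwLaw_parts`).  This is the lattice
  form of the integration by parts `∫ φᵐ sin²k₁ dk = (2d/(m+1)) ∫ φ^{m+1} cos k₁ dk` (`φ` the structure function); on the kernel
  side it is the ballot identity `(a+1)(C(a,p−1) − C(a,p)) = (2p−a−1)·C(a+1,p)` (`walk1_ballot`) applied termwise to the
  last-coordinate peeling `G_succ` of the tree's binomial kernel, with `(m+1)C(m,a) = (a+1)C(m+1,a+1)`.
* **§3 the one-step recursion** at `0`, `e₁`, `e₁+e₂` (definition of `srwLaw`), with §1 to identify the neighbours' classes.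

## What is typed (`d = 3`, §3–§4; all `m, n : ℕ`; standard axioms, no `sorry`, no numerics)

* `srwLaw_three_origin_succ : p_{m+1}(0) = p_m(e₁)`;  `srwLaw_three_e1_succ : 6p_{m+1}(e₁) = p_m(0) + p_m(2e₁) + 4p_m(e₁+e₂)`;
  `srwLaw_three_e12_succ : 6p_{m+1}(e₁+e₂) = 2p_m(e₁) + 2p_m(2e₁+e₂) + 2p_m(e₁+e₂+e₃)`;
* `srwLaw_three_parts_zero : (m+1)(p_m(0) − p_m(2e₁)) = 6p_{m+1}(e₁)`;  `srwLaw_three_parts_e1 : (m+1)(p_m(e₁) − p_m(2e₁+e₂)) =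
  6p_{m+1}(e₁+e₂)`;  `srwLaw_three_parts_e1' : (m+1)(p_m(e₁) − p_m(3e₁)) = 12p_{m+1}(2e₁)`;
* the class formulas (`qₖ = p_{2k}(0)`): `srwLaw_three_class_1 : p_{2n+1}(e₁) = q_{n+1}`,
  `srwLaw_three_class_2 : p_{2n}(2e₁) = qₙ − 6q_{n+1}/(2n+1)`, `srwLaw_three_class_11 : p_{2n}(e₁+e₂) = 3(n+1)q_{n+1}/(2n+1) − qₙ/2`,
  `srwLaw_three_class_3 : p_{2n+1}(3e₁) = q_{n+1} − 6p_{2n+2}(2e₁)/(n+1)`, `srwLaw_three_class_21 : p_{2n+1}(2e₁+e₂) = q_{n+1} −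
  3p_{2n+2}(e₁+e₂)/(n+1)`, `srwLaw_three_class_111 : p_{2n+1}(e₁+e₂+e₃) = 3p_{2n+2}(e₁+e₂) − q_{n+1} − p_{2n+1}(2e₁+e₂)`
  (substituting the first three into the last three expresses every class through `qₙ, q_{n+1}, q_{n+2}`; e.g.
  `p_{2n+1}(e₁+e₂+e₃) = (6(n+1)q_{n+1} − (2n+1)qₙ)/(4(n+2))`).

Sites are the coordinate vectors `![1,0,0], ![2,0,0], ![1,1,0], ![3,0,0], ![2,1,0], ![1,1,1] : Fin 3 → ℤ` (the form in which
the `(2̃,1)` system of the tree consumes `srwI 3 1 0 x`).  AS PRINTED: HSS93 tabulate the resulting numbers `C₀(0,x)` for `d = 3`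
(Table 4) without stating these relations; the relations are folklore consequences of the cubic symmetry and of `Δ`-harmonicity
/ the Fourier representation, recorded here because the tree's kernel is the binomial dimension recursion, not the Fourier integral.
Validated numerically against brute-force walk counts for `m ≤ 11` before typing (lane log).
-/

namespace Literature.Probability.RandomPlanarGeometry.SAW.Zd.LoopErasure

open Finset
open Literature.Barriers.CriticalPhenomena.LongRangePhi4 (srwLaw srwLaw_nonneg srwLaw_zero_apply srwLaw_succ_apply)
open Literature.Probability.FitznerVanDerHofstad2017 (SgnPermPair spAct spAct_apply srwLaw_spAct)
open Literature.Probability.FitznerVanDerHofstad2017.SrwCount (coordD G G_succ G_zero G_congr srwCount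
  srwLaw_eq_srwCount_div walk1 walk1_zero walk1_neg walk1_closed walk1_nat_eq_zero_of_odd walk1_nat_eq_zero_of_lt)

namespace GreenThree

variable {d : ℕ}

/-! ### §1 Symmetries of the `n`-step law (the tree's signed-permutation invariance `srwLaw_spAct`, concrete form) -/

/-- Transport along a signed permutation, concrete form: if `u = spAct τ x` (`u_i = ε_i x_{σ i}`) then `pₙ(u) = pₙ(x)` — the
tree's `srwLaw_spAct`. [cite: HaraSladeSokal1993, Appendix A.1 p. 27 (the lattice symmetries used to group the sites x of C₀(0,x)); folklore] -/
theorem srwLaw_eq_of_spAct (τ : SgnPermPair d) (n : ℕ) (x u : Fin d → ℤ) (hu : u = spAct τ x) :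
    srwLaw d n u = srwLaw d n x := by
  rw [hu]
  exact srwLaw_spAct τ n x

/-! ### §2 Summation by parts in one coordinate: `(m+1)·(c_m(x', t−1) − c_m(x', t+1)) = t · c_{m+1}(x', t)` -/

/-- **The ballot step** behind the summation by parts: `(a+1)(w_a(t−1) − w_a(t+1)) = t · w_{a+1}(t)` for the numbers
`w_a(y)` of `a`-step `±1` walks from `0` to `y` — i.e. `(a+1)(C(a,p−1) − C(a,p)) = (2p−a−1)·C(a+1,p)`.
[cite: HaraSladeSokal1993, Appendix A.1 pp. 28–30 (the one-dimensional structure of the simple-random-walk kernel); folklore] -/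
theorem walk1_ballot (a t : ℕ) :
    ((a + 1 : ℕ) : ℤ) * ((walk1 a ((t : ℤ) - 1) : ℤ) - walk1 a ((t : ℤ) + 1)) = (t : ℤ) * walk1 (a + 1) (t : ℤ) := by
  rcases Nat.eq_zero_or_pos t with rfl | ht
  · have h : walk1 a ((0 : ℕ) - 1 : ℤ) = walk1 a (((0 : ℕ) : ℤ) + 1) := by
      rw [show (((0 : ℕ) : ℤ) - 1) = -((((0 : ℕ) : ℤ) + 1)) by simp, walk1_neg]
    rw [h, sub_self, mul_zero, Nat.cast_zero, zero_mul]
  obtain ⟨s, rfl⟩ : ∃ s, t = s + 1 := ⟨t - 1, by omega⟩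
  have e1 : (((s + 1 : ℕ) : ℤ) - 1) = ((s : ℕ) : ℤ) := by push_cast; ring
  have e2 : (((s + 1 : ℕ) : ℤ) + 1) = ((s + 2 : ℕ) : ℤ) := by push_cast; ring
  rw [e1, e2]
  by_cases hpar : (a + s) % 2 = 0
  · rcases lt_or_ge a s with hlt | hle
    · -- below the light cone: all three counts vanish
      rw [walk1_nat_eq_zero_of_lt a s hlt, walk1_nat_eq_zero_of_lt a (s + 2) (by omega),
        walk1_nat_eq_zero_of_lt (a + 1) (s + 1) (by omega)]
      simp
    · obtain ⟨k, hk⟩ : ∃ k, a = 2 * k + s := ⟨(a - s) / 2, by omega⟩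
      rw [walk1_closed a k s hk, walk1_closed (a + 1) k (s + 1) (by omega)]
      rcases k with _ | k'
      · -- `a = s`: `w_a(s+2) = 0`, `C(a,0) = C(a+1,0) = 1`
        rw [walk1_nat_eq_zero_of_lt a (s + 2) (by omega)]
        simp only [Nat.choose_zero_right, Nat.cast_one, Nat.cast_zero, sub_zero, mul_one]
        push_cast
        omega
      · rw [walk1_closed a k' (s + 2) (by omega)]
        have f1 : ((a + 1 : ℕ) : ℤ) * (a.choose k' : ℕ) = ((a + 1).choose (k' + 1) : ℕ) * ((k' + 1 : ℕ) : ℤ) := by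
          exact_mod_cast Nat.add_one_mul_choose_eq a k'
        have f2 : ((a + 1 : ℕ) : ℤ) * (a.choose (k' + 1) : ℕ) = ((a + 1).choose (k' + 2) : ℕ) * ((k' + 2 : ℕ) : ℤ) := by
          exact_mod_cast Nat.add_one_mul_choose_eq a (k' + 1)
        have f3' : (a + 1).choose (k' + 2) * (k' + 2) = (a + 1).choose (k' + 1) * (a + 1 - (k' + 1)) :=
          Nat.choose_succ_right_eq (a + 1) (k' + 1)
        have f3 : (((a + 1).choose (k' + 2) : ℕ) : ℤ) * ((k' + 2 : ℕ) : ℤ) =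
            ((a + 1).choose (k' + 1) : ℕ) * (((a : ℕ) : ℤ) - k') := by
          have hle : k' + 1 ≤ a + 1 := by omega
          have := congrArg (fun n : ℕ => (n : ℤ)) f3'
          simp only [Nat.cast_mul, Nat.cast_sub hle] at this
          push_cast at this ⊢
          linarith
        have hk' : ((a : ℕ) : ℤ) = 2 * k' + 2 + s := by exact_mod_cast (by omega : a = 2 * k' + 2 + s)
        push_cast at f1 f2 f3 hk' ⊢
        linear_combination f2 + f3 - f1 + (((a + 1).choose (k' + 1) : ℕ) : ℤ) * hk'
  · -- wrong parity: all three counts vanish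
    rw [walk1_nat_eq_zero_of_odd a s (by omega), walk1_nat_eq_zero_of_odd a (s + 2) (by omega),
      walk1_nat_eq_zero_of_odd (a + 1) (s + 1) (by omega)]
    simp

/-- **Summation by parts in the last coordinate** (the lattice form of `∫ φᵐ sin² k = (2d/(m+1)) ∫ φ^{m+1} cos k`): for three
sites of `ℤ^{d+1}` that agree in the first `d` coordinates and have last coordinates `t − 1`, `t + 1`, `t` (`t ∈ ℕ`),
`(m+1) · (c_m(x⁻) − c_m(x⁺)) = t · c_{m+1}(x⁰)` — peel the last coordinate (`G_succ`) and apply the ballot step termwise with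
`(m+1) C(m,a) = (a+1) C(m+1,a+1)`.
[cite: HaraSladeSokal1993, Appendix A.1 pp. 28–30 (relations among the values C₀(0,x) at neighbouring sites); folklore] -/
theorem srwCount_parts (m t : ℕ) (xm xp x0 : Fin (d + 1) → ℤ) (hm : ∀ i < d, coordD xm i = coordD x0 i)
    (hp : ∀ i < d, coordD xp i = coordD x0 i) (h0 : coordD x0 d = t) (hm' : coordD xm d = (t : ℤ) - 1)
    (hp' : coordD xp d = (t : ℤ) + 1) :
    ((m + 1 : ℕ) : ℤ) * ((srwCount (d + 1) m xm : ℤ) - srwCount (d + 1) m xp) =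
      (t : ℤ) * srwCount (d + 1) (m + 1) x0 := by
  unfold srwCount
  rw [G_succ, G_succ, G_succ, hm', hp', h0, Finset.Nat.sum_antidiagonal_eq_sum_range_succ_mk,
    Finset.Nat.sum_antidiagonal_eq_sum_range_succ_mk, Finset.Nat.sum_antidiagonal_eq_sum_range_succ_mk]
  have gm : ∀ b, G xm d b = G x0 d b := fun b => G_congr d hm b
  have gp : ∀ b, G xp d b = G x0 d b := fun b => G_congr d hp b
  simp only [gm, gp]
  rw [Finset.sum_range_succ' (fun a => (m + 1).choose a * (walk1 a (t : ℤ) * G x0 d (m + 1 - a)))]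
  push_cast
  have hz : (t : ℤ) * ((((m + 1).choose 0 : ℕ) : ℤ) * (((walk1 0 (t : ℤ) : ℕ) : ℤ) * ((G x0 d (m + 1) : ℕ) : ℤ))) = 0 := by
    rcases Nat.eq_zero_or_pos t with rfl | ht
    · simp
    · rw [walk1_zero, if_neg (by exact_mod_cast ht.ne')]
      simp
  rw [← Finset.sum_sub_distrib, Finset.mul_sum, mul_add, hz, add_zero, Finset.mul_sum]
  refine Finset.sum_congr rfl fun a _ => ?_
  have key := walk1_ballot a t
  have hc : ((m + 1 : ℕ) : ℤ) * (m.choose a : ℕ) = ((m + 1).choose (a + 1) : ℕ) * ((a + 1 : ℕ) : ℤ) := by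
    exact_mod_cast Nat.add_one_mul_choose_eq m a
  push_cast at key hc ⊢
  linear_combination (((G x0 d (m - a) : ℕ) : ℤ) * ((((walk1 a ((t : ℤ) - 1)) : ℕ) : ℤ) - (((walk1 a ((t : ℤ) + 1)) : ℕ) : ℤ))) * hc +
    ((((m + 1).choose (a + 1) : ℕ) : ℤ) * (((G x0 d (m - a)) : ℕ) : ℤ)) * key

/-- The same identity for the `n`-step law: `(m+1)(p_m(x⁻) − p_m(x⁺)) = 2(d+1)·t·p_{m+1}(x⁰)`.
[cite: HaraSladeSokal1993, Appendix A.1 pp. 28–30 (relations among the values C₀(0,x) at neighbouring sites); folklore] -/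
theorem srwLaw_parts (m t : ℕ) (xm xp x0 : Fin (d + 1) → ℤ) (hm : ∀ i < d, coordD xm i = coordD x0 i)
    (hp : ∀ i < d, coordD xp i = coordD x0 i) (h0 : coordD x0 d = t) (hm' : coordD xm d = (t : ℤ) - 1)
    (hp' : coordD xp d = (t : ℤ) + 1) :
    ((m + 1 : ℕ) : ℝ) * (srwLaw (d + 1) m xm - srwLaw (d + 1) m xp) =
      (2 * ((d + 1 : ℕ) : ℝ)) * t * srwLaw (d + 1) (m + 1) x0 := by
  have key := congrArg (fun z : ℤ => (z : ℝ)) (srwCount_parts m t xm xp x0 hm hp h0 hm' hp')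
  push_cast at key ⊢
  rw [srwLaw_eq_srwCount_div, srwLaw_eq_srwCount_div, srwLaw_eq_srwCount_div, pow_succ]
  have hD : (2 * (((d + 1 : ℕ) : ℝ))) ≠ 0 := by positivity
  have hDm : (2 * (((d + 1 : ℕ) : ℝ))) ^ m ≠ 0 := by positivity
  push_cast at hD hDm ⊢
  rw [show ((m : ℝ) + 1) * ((srwCount (d + 1) m xm : ℝ) / (2 * ((d : ℝ) + 1)) ^ m -
      (srwCount (d + 1) m xp : ℝ) / (2 * ((d : ℝ) + 1)) ^ m) =
      (((m : ℝ) + 1) * ((srwCount (d + 1) m xm : ℝ) - srwCount (d + 1) m xp)) / (2 * ((d : ℝ) + 1)) ^ m by ring, key]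
  field_simp

/-! ### §3 `d = 3`: the six relations among the classes `0, e₁, 2e₁, e₁+e₂, 3e₁, 2e₁+e₂, e₁+e₂+e₃` -/

/-- Coordinate swaps in `ℤ³`: `pₙ(0,0,a) = pₙ(a,0,0)`, `pₙ(0,a,0) = pₙ(a,0,0)`, `pₙ(a,0,b) = pₙ(a,b,0)`, `pₙ(b,a,0) = pₙ(a,b,0)`.
[cite: HaraSladeSokal1993, Appendix A.1 p. 27 (the lattice symmetries used to group the sites x of C₀(0,x)); folklore] -/
theorem srwLaw_three_swaps (n : ℕ) (a b : ℤ) :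
    srwLaw 3 n ![0, 0, a] = srwLaw 3 n ![a, 0, 0] ∧ srwLaw 3 n ![0, a, 0] = srwLaw 3 n ![a, 0, 0] ∧
      srwLaw 3 n ![a, 0, b] = srwLaw 3 n ![a, b, 0] ∧ srwLaw 3 n ![b, a, 0] = srwLaw 3 n ![a, b, 0] := by
  refine ⟨srwLaw_eq_of_spAct (Equiv.swap 0 2, fun _ => 1) n _ _ ?_, srwLaw_eq_of_spAct (Equiv.swap 0 1, fun _ => 1) n _ _ ?_,
    srwLaw_eq_of_spAct (Equiv.swap 1 2, fun _ => 1) n _ _ ?_, srwLaw_eq_of_spAct (Equiv.swap 0 1, fun _ => 1) n _ _ ?_⟩ <;>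
  (funext i; fin_cases i <;> simp [spAct_apply, Equiv.swap_apply_def])

/-- `pₙ` is even in each coordinate of `ℤ³`: `pₙ(−a,b,c) = pₙ(a,b,c)`, `pₙ(a,−b,c) = pₙ(a,b,c)`, `pₙ(a,b,−c) = pₙ(a,b,c)`.
[cite: HaraSladeSokal1993, Appendix A.1 p. 27 (the lattice symmetries used to group the sites x of C₀(0,x)); folklore] -/
theorem srwLaw_three_reflects (n : ℕ) (a b c : ℤ) :
    srwLaw 3 n ![-a, b, c] = srwLaw 3 n ![a, b, c] ∧ srwLaw 3 n ![a, -b, c] = srwLaw 3 n ![a, b, c] ∧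
      srwLaw 3 n ![a, b, -c] = srwLaw 3 n ![a, b, c] := by
  refine ⟨srwLaw_eq_of_spAct (1, fun i => if i = 0 then -1 else 1) n _ _ ?_,
    srwLaw_eq_of_spAct (1, fun i => if i = 1 then -1 else 1) n _ _ ?_,
    srwLaw_eq_of_spAct (1, fun i => if i = 2 then -1 else 1) n _ _ ?_⟩ <;>
  (funext i; fin_cases i <;> simp [spAct_apply])

/-- **The return step**: `p_{m+1}(0) = p_m(e₁)` (the six neighbours of the origin all carry the class value `p_m(e₁)`).
[cite: HaraSladeSokal1993, Appendix A.1 pp. 28–30 (relations among the values C₀(0,x) at neighbouring sites); folklore] -/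
theorem srwLaw_three_origin_succ (m : ℕ) : srwLaw 3 (m + 1) (0 : Fin 3 → ℤ) = srwLaw 3 m ![1, 0, 0] := by
  rw [srwLaw_succ_apply, Fin.sum_univ_three]
  have v1 : (0 : Fin 3 → ℤ) + Pi.single 0 1 = ![1, 0, 0] := by funext i; fin_cases i <;> rfl
  have v2 : (0 : Fin 3 → ℤ) - Pi.single 0 1 = ![-1, 0, 0] := by funext i; fin_cases i <;> rfl
  have v3 : (0 : Fin 3 → ℤ) + Pi.single 1 1 = ![0, 1, 0] := by funext i; fin_cases i <;> rfl
  have v4 : (0 : Fin 3 → ℤ) - Pi.single 1 1 = ![0, -1, 0] := by funext i; fin_cases i <;> rfl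
  have v5 : (0 : Fin 3 → ℤ) + Pi.single 2 1 = ![0, 0, 1] := by funext i; fin_cases i <;> rfl
  have v6 : (0 : Fin 3 → ℤ) - Pi.single 2 1 = ![0, 0, -1] := by funext i; fin_cases i <;> rfl
  rw [v1, v2, v3, v4, v5, v6, (srwLaw_three_reflects m 1 0 0).1,
    show (![0, -1, 0] : Fin 3 → ℤ) = ![0, -(1 : ℤ), 0] from rfl, (srwLaw_three_reflects m 0 1 0).2.1,
    show (![0, 0, -1] : Fin 3 → ℤ) = ![0, 0, -(1 : ℤ)] from rfl, (srwLaw_three_reflects m 0 0 1).2.2,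
    (srwLaw_three_swaps m 1 0).1, (srwLaw_three_swaps m 1 0).2.1]
  push_cast
  ring

/-- **The step into `e₁`**: `6 p_{m+1}(e₁) = p_m(0) + p_m(2e₁) + 4 p_m(e₁+e₂)`.
[cite: HaraSladeSokal1993, Appendix A.1 pp. 28–30 (relations among the values C₀(0,x) at neighbouring sites); folklore] -/
theorem srwLaw_three_e1_succ (m : ℕ) :
    6 * srwLaw 3 (m + 1) ![1, 0, 0] = srwLaw 3 m (0 : Fin 3 → ℤ) + srwLaw 3 m ![2, 0, 0] + 4 * srwLaw 3 m ![1, 1, 0] := by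
  rw [srwLaw_succ_apply, Fin.sum_univ_three]
  have v1 : (![1, 0, 0] : Fin 3 → ℤ) + Pi.single 0 1 = ![2, 0, 0] := by funext i; fin_cases i <;> rfl
  have v2 : (![1, 0, 0] : Fin 3 → ℤ) - Pi.single 0 1 = 0 := by funext i; fin_cases i <;> rfl
  have v3 : (![1, 0, 0] : Fin 3 → ℤ) + Pi.single 1 1 = ![1, 1, 0] := by funext i; fin_cases i <;> rfl
  have v4 : (![1, 0, 0] : Fin 3 → ℤ) - Pi.single 1 1 = ![1, -1, 0] := by funext i; fin_cases i <;> rfl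
  have v5 : (![1, 0, 0] : Fin 3 → ℤ) + Pi.single 2 1 = ![1, 0, 1] := by funext i; fin_cases i <;> rfl
  have v6 : (![1, 0, 0] : Fin 3 → ℤ) - Pi.single 2 1 = ![1, 0, -1] := by funext i; fin_cases i <;> rfl
  rw [v1, v2, v3, v4, v5, v6, show (![1, -1, 0] : Fin 3 → ℤ) = ![1, -(1 : ℤ), 0] from rfl,
    (srwLaw_three_reflects m 1 1 0).2.1, show (![1, 0, -1] : Fin 3 → ℤ) = ![1, 0, -(1 : ℤ)] from rfl,
    (srwLaw_three_reflects m 1 0 1).2.2, (srwLaw_three_swaps m 1 1).2.2.1]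
  push_cast
  ring

/-- **The step into `e₁+e₂`**: `6 p_{m+1}(e₁+e₂) = 2 p_m(e₁) + 2 p_m(2e₁+e₂) + 2 p_m(e₁+e₂+e₃)`.
[cite: HaraSladeSokal1993, Appendix A.1 pp. 28–30 (relations among the values C₀(0,x) at neighbouring sites); folklore] -/
theorem srwLaw_three_e12_succ (m : ℕ) :
    6 * srwLaw 3 (m + 1) ![1, 1, 0] = 2 * srwLaw 3 m ![1, 0, 0] + 2 * srwLaw 3 m ![2, 1, 0] + 2 * srwLaw 3 m ![1, 1, 1] := by
  rw [srwLaw_succ_apply, Fin.sum_univ_three]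
  have v1 : (![1, 1, 0] : Fin 3 → ℤ) + Pi.single 0 1 = ![2, 1, 0] := by funext i; fin_cases i <;> rfl
  have v2 : (![1, 1, 0] : Fin 3 → ℤ) - Pi.single 0 1 = ![0, 1, 0] := by funext i; fin_cases i <;> rfl
  have v3 : (![1, 1, 0] : Fin 3 → ℤ) + Pi.single 1 1 = ![1, 2, 0] := by funext i; fin_cases i <;> rfl
  have v4 : (![1, 1, 0] : Fin 3 → ℤ) - Pi.single 1 1 = ![1, 0, 0] := by funext i; fin_cases i <;> rfl
  have v5 : (![1, 1, 0] : Fin 3 → ℤ) + Pi.single 2 1 = ![1, 1, 1] := by funext i; fin_cases i <;> rfl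
  have v6 : (![1, 1, 0] : Fin 3 → ℤ) - Pi.single 2 1 = ![1, 1, -1] := by funext i; fin_cases i <;> rfl
  rw [v1, v2, v3, v4, v5, v6, (srwLaw_three_swaps m 1 0).2.1, (srwLaw_three_swaps m 2 1).2.2.2,
    show (![1, 1, -1] : Fin 3 → ℤ) = ![1, 1, -(1 : ℤ)] from rfl, (srwLaw_three_reflects m 1 1 1).2.2]
  push_cast
  ring

/-- **Parts at the origin**: `(m+1)(p_m(0) − p_m(2e₁)) = 6 p_{m+1}(e₁)`.
[cite: HaraSladeSokal1993, Appendix A.1 pp. 28–30 (relations among the values C₀(0,x) at neighbouring sites); folklore] -/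
theorem srwLaw_three_parts_zero (m : ℕ) :
    ((m + 1 : ℕ) : ℝ) * (srwLaw 3 m (0 : Fin 3 → ℤ) - srwLaw 3 m ![2, 0, 0]) = 6 * srwLaw 3 (m + 1) ![1, 0, 0] := by
  have h := srwLaw_parts (d := 2) m 1 ![0, 0, 0] ![0, 0, 2] ![0, 0, 1] (by decide) (by decide) (by decide) (by decide)
    (by decide)
  rw [show (![0, 0, 0] : Fin 3 → ℤ) = 0 from by funext i; fin_cases i <;> rfl, (srwLaw_three_swaps m 2 0).1,
    (srwLaw_three_swaps (m + 1) 1 0).1] at h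
  push_cast at h ⊢
  linarith

/-- **Parts at `e₁`** (second direction): `(m+1)(p_m(e₁) − p_m(2e₁+e₂)) = 6 p_{m+1}(e₁+e₂)`.
[cite: HaraSladeSokal1993, Appendix A.1 pp. 28–30 (relations among the values C₀(0,x) at neighbouring sites); folklore] -/
theorem srwLaw_three_parts_e1 (m : ℕ) :
    ((m + 1 : ℕ) : ℝ) * (srwLaw 3 m ![1, 0, 0] - srwLaw 3 m ![2, 1, 0]) = 6 * srwLaw 3 (m + 1) ![1, 1, 0] := by
  have h := srwLaw_parts (d := 2) m 1 ![1, 0, 0] ![1, 0, 2] ![1, 0, 1] (by decide) (by decide) (by decide) (by decide)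
    (by decide)
  rw [(srwLaw_three_swaps m 1 2).2.2.1, (srwLaw_three_swaps m 2 1).2.2.2, (srwLaw_three_swaps (m + 1) 1 1).2.2.1] at h
  push_cast at h ⊢
  linarith

/-- **Parts along `e₁`** (`t = 2`): `(m+1)(p_m(e₁) − p_m(3e₁)) = 12 p_{m+1}(2e₁)`.
[cite: HaraSladeSokal1993, Appendix A.1 pp. 28–30 (relations among the values C₀(0,x) at neighbouring sites); folklore] -/
theorem srwLaw_three_parts_e1' (m : ℕ) :
    ((m + 1 : ℕ) : ℝ) * (srwLaw 3 m ![1, 0, 0] - srwLaw 3 m ![3, 0, 0]) = 12 * srwLaw 3 (m + 1) ![2, 0, 0] := by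
  have h := srwLaw_parts (d := 2) m 2 ![0, 0, 1] ![0, 0, 3] ![0, 0, 2] (by decide) (by decide) (by decide) (by decide)
    (by decide)
  rw [(srwLaw_three_swaps m 1 0).1, (srwLaw_three_swaps m 3 0).1, (srwLaw_three_swaps (m + 1) 2 0).1] at h
  push_cast at h ⊢
  linarith

/-! ### §4 The classes as explicit combinations of `qₙ = p₂ₙ(0)` -/

/-- **`p_{2n+1}(e₁) = q_{n+1}`**. [cite: HaraSladeSokal1993, Appendix A.1 Table 4 (the values C₀(0,x), |x|₁ ≤ 3, d = 3); lane certificate] -/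
theorem srwLaw_three_class_1 (n : ℕ) : srwLaw 3 (2 * n + 1) ![1, 0, 0] = srwLaw 3 (2 * (n + 1)) (0 : Fin 3 → ℤ) := by
  rw [show 2 * (n + 1) = (2 * n + 1) + 1 by ring, srwLaw_three_origin_succ]

/-- **`p_{2n}(2e₁) = qₙ − 6 q_{n+1}/(2n+1)`**.
[cite: HaraSladeSokal1993, Appendix A.1 Table 4 (the values C₀(0,x), |x|₁ ≤ 3, d = 3); lane certificate] -/
theorem srwLaw_three_class_2 (n : ℕ) : srwLaw 3 (2 * n) ![2, 0, 0] =
    srwLaw 3 (2 * n) (0 : Fin 3 → ℤ) - 6 * srwLaw 3 (2 * (n + 1)) (0 : Fin 3 → ℤ) / (2 * n + 1) := by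
  have h := srwLaw_three_parts_zero (2 * n)
  rw [srwLaw_three_class_1 n] at h
  push_cast at h
  have hn : (0 : ℝ) < 2 * n + 1 := by positivity
  field_simp
  linarith

/-- **`p_{2n}(e₁+e₂) = 3(n+1) q_{n+1}/(2n+1) − qₙ/2`**.
[cite: HaraSladeSokal1993, Appendix A.1 Table 4 (the values C₀(0,x), |x|₁ ≤ 3, d = 3); lane certificate] -/
theorem srwLaw_three_class_11 (n : ℕ) : srwLaw 3 (2 * n) ![1, 1, 0] =
    3 * (n + 1) * srwLaw 3 (2 * (n + 1)) (0 : Fin 3 → ℤ) / (2 * n + 1) - srwLaw 3 (2 * n) (0 : Fin 3 → ℤ) / 2 := by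
  have h := srwLaw_three_e1_succ (2 * n)
  rw [srwLaw_three_class_1 n, srwLaw_three_class_2 n] at h
  have hn : (0 : ℝ) < 2 * n + 1 := by positivity
  field_simp
  field_simp at h
  linarith

/-- **`p_{2n+1}(3e₁) = q_{n+1} − 6 p_{2n+2}(2e₁)/(n+1)`**.
[cite: HaraSladeSokal1993, Appendix A.1 Table 4 (the values C₀(0,x), |x|₁ ≤ 3, d = 3); lane certificate] -/
theorem srwLaw_three_class_3 (n : ℕ) : srwLaw 3 (2 * n + 1) ![3, 0, 0] =
    srwLaw 3 (2 * (n + 1)) (0 : Fin 3 → ℤ) - 6 * srwLaw 3 (2 * (n + 1)) ![2, 0, 0] / (n + 1) := by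
  have h := srwLaw_three_parts_e1' (2 * n + 1)
  rw [srwLaw_three_class_1 n, show 2 * n + 1 + 1 = 2 * (n + 1) by ring] at h
  push_cast at h
  have hn : (0 : ℝ) < n + 1 := by positivity
  field_simp
  linarith

/-- **`p_{2n+1}(2e₁+e₂) = q_{n+1} − 3 p_{2n+2}(e₁+e₂)/(n+1)`**.
[cite: HaraSladeSokal1993, Appendix A.1 Table 4 (the values C₀(0,x), |x|₁ ≤ 3, d = 3); lane certificate] -/
theorem srwLaw_three_class_21 (n : ℕ) : srwLaw 3 (2 * n + 1) ![2, 1, 0] =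
    srwLaw 3 (2 * (n + 1)) (0 : Fin 3 → ℤ) - 3 * srwLaw 3 (2 * (n + 1)) ![1, 1, 0] / (n + 1) := by
  have h := srwLaw_three_parts_e1 (2 * n + 1)
  rw [srwLaw_three_class_1 n, show 2 * n + 1 + 1 = 2 * (n + 1) by ring] at h
  push_cast at h
  have hn : (0 : ℝ) < n + 1 := by positivity
  field_simp
  linarith

/-- **`p_{2n+1}(e₁+e₂+e₃) = 3 p_{2n+2}(e₁+e₂) − q_{n+1} − p_{2n+1}(2e₁+e₂)`**.
[cite: HaraSladeSokal1993, Appendix A.1 Table 4 (the values C₀(0,x), |x|₁ ≤ 3, d = 3); lane certificate] -/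
theorem srwLaw_three_class_111 (n : ℕ) : srwLaw 3 (2 * n + 1) ![1, 1, 1] =
    3 * srwLaw 3 (2 * (n + 1)) ![1, 1, 0] - srwLaw 3 (2 * (n + 1)) (0 : Fin 3 → ℤ) - srwLaw 3 (2 * n + 1) ![2, 1, 0] := by
  have h := srwLaw_three_e12_succ (2 * n + 1)
  rw [srwLaw_three_class_1 n, show 2 * n + 1 + 1 = 2 * (n + 1) by ring] at h
  linarith

end GreenThree

end Literature.Probability.RandomPlanarGeometry.SAW.Zd.LoopErasure
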